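import Summits.Ventures.QEC.CircuitDistance.PortK2DataBB144X
import Summits.Ventures.QEC.CircuitDistance.K2Chunks
import HarnessLib

/-!
# K2(`[[144,12,12]]`) chunk module — COMPUTATIONAL (native_decide; `Lean.ofReduceBool`)

Cell `qec`, CDX, R146/R152 STEP 1 («computational» header; `ofReduceBool` confined to these chunk modules). Checker of record
`K2.K2Data` (qec-cdx-type-1, PortK2Check); data module of record `PortK2DataBB144X/Z` (p669158/9, crit-1 data audit PASS
2026-08-28T21:20Z); chunk glue `K2Chunks` (idea-1 g2). Cube 1, child 8: leaf group 1 of 3.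
Leaf theorems: the K2 DFS accepts below one descendant state of pivot cube 1 (sector X); sizes are exact DFS visit counts
(eng-1 g2 `k2count.c`), capped so that the gate's native-axiom audit re-verifies every leaf in place. Assemblies re-derive the
child lists in the kernel (`decide`) and end in the literal cube fact `d144X.cube (Ts144X.getD 1 []) (72) (lives144X.getD 1 0) = true`
(the `hcubes` hypothesis of `K2Inst.k2_complete`). Emitted by qec-cdx-eng-1 g2 (`gen2.py`, idea-1's `gen_k2chunks_from_lean.py` lineage).
-/

namespace Summit.Ventures.QEC.CircuitDistance.K2

set_option maxRecDepth 100000 in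
set_option maxHeartbeats 0 in
set_option exponentiation.threshold 1024 in
/-- K2(144) chunk fact `cube144X1_ch8_0` (578961 DFS visits; see the module docstring). -/
theorem cube144X1_ch8_0 : app5 (d144X.dfs (Ts144X.getD 1 []) 6) (135071752, 781, 842498333348457493583344221469363458551160777371492338643423461376, 3, 2348542582773833227889480596789337027375681652924647906770665052764816581885321986345979031044624901667291136) = true := by native_decide

set_option maxRecDepth 100000 in
set_option maxHeartbeats 0 in
set_option exponentiation.threshold 1024 in
/-- K2(144) chunk fact `cube144X1_ch8_1` (467295 DFS visits; see the module docstring). -/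
theorem cube144X1_ch8_1 : app5 (d144X.dfs (Ts144X.getD 1 []) 6) (432345564362115072, 1869, 842498333348457493583344221809645825472099231390133980335901245440, 3, 2348542582773833227889480596789337027375681652924647906770665052764816241602955065407515567670017469899079680) = true := by native_decide

set_option maxRecDepth 100000 in
set_option maxHeartbeats 0 in
set_option exponentiation.threshold 1024 in
/-- K2(144) chunk fact `cube144X1_ch8_2` (594546 DFS visits; see the module docstring). -/
theorem cube144X1_ch8_2 : app5 (d144X.dfs (Ts144X.getD 1 []) 6) (8590131200, 2048, 842498333348457493583522627430951703536293053672940559796180877312, 3, 2348542582773833227889480596789337027375681652924647906770665052586410280014710080275229821488830577851236352) = true := by native_decide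

set_option maxRecDepth 100000 in
set_option maxHeartbeats 0 in
set_option exponentiation.threshold 1024 in
/-- K2(144) chunk fact `cube144X1_ch8_3` (209196 DFS visits; see the module docstring). -/
theorem cube144X1_ch8_3 : app5 (d144X.dfs (Ts144X.getD 1 []) 6) (332334136098778580992, 3597, 842498333740776352045011769209100297501639918933156588183135191040, 3, 2348542582773833227889480596789337027375681652924647514451806590918862540277871129796078815091615298849079296) = true := by native_decide

set_option maxRecDepth 100000 in
set_option maxHeartbeats 0 in
set_option exponentiation.threshold 1024 in
/-- K2(144) chunk fact `cube144X1_ch8_4` (237133 DFS visits; see the module docstring). -/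
theorem cube144X1_ch8_4 : app5 (d144X.dfs (Ts144X.getD 1 []) 6) (2379918778834771839232, 2125, 842498358456864435130067276812521151381826432336181150760271085568, 3, 2348542582773833227889480596789337027375681652924622406044865044195807197120178299130414405669837442711027712) = true := by native_decide
end Summit.Ventures.QEC.CircuitDistance.K2
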